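import Literature.NumberTheory.Automorphic.Liu2021.LemD1Item4AtV2NonsplitEpsOfIsotropic
import HarnessLib

/-!
# [Liu2021, Lem. D.1 (4)], `(ε, χ)`-clauses (→) at a NON-SPLIT place on the rank-`≥ 2` indexed family, ROAD-AGNOSTIC FORM: from the
# SEPARATION of the two transported rank-one theta lifts at that place (the body of ★ `rankOne_theta_lines_disjoint` at `v`) — THEOREMS ONLY

Topic `NumberTheory/Automorphic/Liu2021`; namespace `Literature.NumberTheory.Automorphic.Liu2021.Def411WeilCarriers`.  KERNEL ONLY: theorems (+ three private
plumbing lemmas); no definition, no named fact, no `sorry`, no instance, no notation.  Cell hodgecm-mathlib, FLOOR 0, half A line LD1 (socket `stub_S1_facts`, #73),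
LD1-p01 (g2); `--supports stmt-HodgeConjecture-24832`.  Nothing of [Liu2021] is asserted.

WHY.  ★ `LemD1Item4AtV2NonsplitEpsOfIsotropic` (p849937) proves the `(ε, χ)`-clauses of [Liu2021, Lem. D.1 (4)] «only if» at a non-split place where `V` is
ISOTROPIC, by plugging the splitting-free disjointness ★ `rankOne_theta_lines_disjoint_of_isotropic` (p849893) into the Liu-side bookkeeping.  At an ANISOTROPIC plane the
splitting-free disjointness is false; there the separation of the two lines' theta lifts must come from the matched splittings (LD bus 2026-09-02, LD2-plan (g2)
DEALS #2: the «block-zero complementarity ∕ (P′)» organ over the ENGINE (α*)).  So that ONE Liu-side consumer serves EVERY non-split place, this file re-cuts the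
bookkeeping with the separation AT THE PLACE as a HYPOTHESIS `hsep` — literally the body of the named fact ★ `rankOne_theta_lines_disjoint` (∕ the conclusion block
of ★ `rankOne_theta_lines_disjoint_of_isotropic`) instantiated at the two members' transported sections `s_j, s_i`, the centre presented at the line `(a_j)`:
«lines `δ'_i ⊗ 1`, `δ'_j ⊗ 1` in different classes → `Θ_{s_j}(χ_{j,v}) ≠ 0` → `Θ_{s_j}(χ_{j,v}) ≅ Θ_{s_i}(χ_{i,v})` → `False`» — together with the letter's own
non-vanishing `Θ_v(j) ≠ 0` (`hnt`, needed off the isotropic locus; transported to the MVW side along the linear equivalence of ★ §1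
`areIsomorphicRep_theta_comp_uEquiv_quot₂`).  No isotropy, no `IsField`, no class hypothesis, no rank restriction beyond `N ≥ 2`.

* §2′ `sameClass_and_chi_eq_of_areIsomorphicRep_nonsplit_of_separation_of_modelTransport` — every rank `N ≥ 2`, line-model transports `(δ′_t, s_t, M_t)`:
  `hsep → hnt → AreIsomorphicRep (quot j) (quot i) → LemD1.SameClass (eps i) (eps j) ∧ chi j = chi i`;
* §3′ `sameClass_and_chi_eq_of_areIsomorphicRep_nonsplit_of_separation_prodUnique` — at `Equiv.prodUnique (Fin N) (Fin 1)`, `s_t := lineTransportSection …`, `M_t = 1`;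
* §4′ `sameClass_and_chi_eq_of_areIsomorphicRep_localType₂_nonsplit_of_separation` — §3′ in the Θ-currency of the θ-package local factors (★ (r1)
  `areIsomorphicRep_localType₂_iff_quot`), the tokens of the LD letters R₂ ∕ L4.
At an isotropic place `hsep := rankOne_theta_lines_disjoint_of_isotropic … ⟨r, hr0, hr⟩` recovers ★ p849937 §2–§4 (there even without `hnt`); at an anisotropic place
`hsep` is the LD2 organ.  ORIENTATION: `hsep` and `hnt` are stated for the member `j` = the FIRST argument of the isomorphism (`quot j ≅ quot i`); a consumer holding
«`Θ_v(a) ≅ Θ_v(a′)` and `Θ_v(a′) ≠ 0`» (the letter R₂) takes `j := a′`, `i := a` and the symmetric isomorphism (★ `AreIsomorphicRep.symm`).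

HONEST SCOPE.  Nothing of [Liu2021] is asserted; HC_CM is proved only modulo the 7 printed citations (2 remaining: hLiu418 = stmt-HodgeConjecture-24832, h413 =
stmt-HodgeConjecture-24833) until rung 0 closes; count-neutral.

## References
* [Liu2021] Y. Liu, Camb. J. Math. 9 (2021) = arXiv:2102.11518 — App. D §D.1 Steps 1–3 (l. 5213–5224), Lemma D.1 (4) (p. 126, l. 5235), proof l. 5257–5262.
* [MoeglinVignerasWaldspurger1987] C. Mœglin, M.-F. Vignéras, J.-L. Waldspurger, LNM 1291 (1987), Chap. 2 II.1, Chap. 3 I.1–I.3, IV.4.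
* [HarrisKudlaSweet1996] M. Harris, S. Kudla, W. J. Sweet, J. AMS 9 (1996), Cor. 4.4, Thm. 6.1.
* [SunZhu2014] B. Sun, C.-B. Zhu, J. AMS 28 (2015), Thm. 1.10.
-/

set_option autoImplicit false

noncomputable section

open scoped Matrix Kronecker
open NumberField IsDedekindDomain
open Literature.NumberTheory.Automorphic Literature.NumberTheory.Automorphic.UnitaryGroup
open Literature.RepresentationTheory
open Literature.RepresentationTheory.HeisenbergGroup (MpPsi)
open Literature.NumberTheory.GelbartRogawski1991 Literature.NumberTheory.GelbartRogawski1991.UnitaryDualPair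
open Literature.NumberTheory.GelbartRogawski1991.UnitaryDualPair.WeilCoinv
open Literature.NumberTheory.GelbartRogawski1991.UnitaryDualPair.LocalSplitting
open Literature.RepresentationTheory.MoeglinVignerasWaldspurger1987

namespace Literature.NumberTheory.Automorphic.Liu2021.Def411WeilCarriers

variable (F E : Type) [Field F] [NumberField F] [Field E] [NumberField E] [Algebra F E]
variable (c : E ≃ₐ[F] E) (N : ℕ) {n : ℕ} (e : Fin N × Fin 1 ≃ Fin n)
variable (JV : Matrix (Fin N) (Fin N) E) {TV : Matrix (Fin N) (Fin N) F}
variable [Algebra.IsQuadraticExtension F E] {δ : E} (hcδ : c δ = -δ) (hδ : δ ≠ 0) {d : F} (hd : δ * δ = algebraMap F E d)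

omit [NumberField F] [NumberField E] [Algebra.IsQuadraticExtension F E] in
/-- `2 ≤ N` when `2 ≤ n` (`N = n` along `e`; plumbing, the family's own rank proof up to proof irrelevance). [folklore] -/
private theorem two_le_rank₂'' (e : Fin N × Fin 1 ≃ Fin n) (hn : 2 ≤ n) : 2 ≤ N := by
  have := Fintype.card_congr e; simp only [Fintype.card_prod, Fintype.card_fin, mul_one] at this; omega

omit [NumberField F] [NumberField E] [Algebra.IsQuadraticExtension F E] in
/-- in a commutative group with an endomorphism `σ`: `a = z · σ z · b ⟹ b = z⁻¹ · σ z⁻¹ · a` (plumbing for the class relation `SameClass`). [folklore] -/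
private theorem eq_inv_mul_of_eq_mul₃ {G : Type*} [CommGroup G] (σ : G →* G) {a b z : G} (h : a = z * σ z * b) :
    b = z⁻¹ * σ z⁻¹ * a := by
  rw [h, map_inv, mul_comm z⁻¹ (σ z)⁻¹]
  group

omit [NumberField F] [NumberField E] [Algebra.IsQuadraticExtension F E] in
/-- in a commutative group with an endomorphism `σ`: if `eᵢ = x σx eⱼ`, `eᵢ = yᵢ σyᵢ Eᵢ`, `eⱼ = yⱼ σyⱼ Eⱼ` then `Eⱼ = w σw Eᵢ` with
`w = (yᵢ⁻¹ x yⱼ)⁻¹` (plumbing for the class relation `SameClass`). [folklore] -/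
private theorem sameClass_witness₃ {G : Type*} [CommGroup G] (σ : G →* G) {ei ej Ei Ej x yi yj : G}
    (hx : ei = x * σ x * ej) (hyi : ei = yi * σ yi * Ei) (hyj : ej = yj * σ yj * Ej) :
    Ej = (yi⁻¹ * x * yj)⁻¹ * σ (yi⁻¹ * x * yj)⁻¹ * Ei := by
  refine eq_inv_mul_of_eq_mul₃ σ ?_
  rw [eq_inv_mul_of_eq_mul₃ σ hyi, hx, hyj, map_mul, map_mul, map_inv]
  simp only [mul_assoc, mul_comm, mul_left_comm]

/-! ## §2′ [Lem. D.1 (4)], `(ε, χ)`-clauses (→) at a NON-SPLIT place from the SEPARATION at that place, every rank `N ≥ 2`, through line-model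
transports -/

/-- **[Liu2021, App. D Lem. D.1 (4)], `(ε, χ)`-CLAUSES (→ direction) AT A NON-SPLIT PLACE on the rank-`≥ 2` indexed family `localIndexedFamilyAtV₂ … v`, FROM
THE SEPARATION OF THE TWO TRANSPORTED RANK-ONE THETA LIFTS AT THAT PLACE, through line-model transports.**  Hypotheses: for every member `t`, an element `δ'_t ≠ 0`
whose representative `δ'_t ⊗ 1` lies in the class of `ε_{t,v} = (a_t δ) ⊗ 1` (`hy`), a HOMOMORPHISM `s_t : U(J_V)(F_v) →* LocalMp F N T_V v` (no condition:
its projection and smoothness are the business of whoever proves `hsep`) and `M_t : 𝒮(F_vᴺ) ≃ 𝒮(F_vⁿ)` intertwining `ω_{s_t}` with `(𝓢_t).omegaLoc v ∘ (k ↦ k ⊗ 1)` (`hM`); the SEPARATION `hsep` = the body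
of ★ `rankOne_theta_lines_disjoint` at `(v, s_j, s_i, χ_{j,v}, χ_{i,v})`, centre at `(a_j)` («different classes → `Θ_{s_j}(χ_j) ≠ 0` → `Θ_{s_j}(χ_j) ≅ Θ_{s_i}(χ_i)`
→ `False`»); the letter's non-vanishing `Θ_v(j) ≠ 0` (`hnt`, coinvariants of `(𝓢_j).omegaLoc v` under the centre).  THEN `AreIsomorphicRep (quot j) (quot i)` forces
`LemD1.SameClass (eps i) (eps j)` AND `chi j = chi i`.  Proof: ★ §1 `areIsomorphicRep_theta_comp_uEquiv_quot₂` for `i`, `j`; `hnt` carried to `Θ_{s_j}(χ_j)` along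
§1's linear equivalence and ★ `nontrivial_localType₂_iff_quot`; the `ε`-clause by contradiction through `hsep`, the `χ`-clause by ★
`rankOne_thetaChar_eq_of_areIsomorphicRep₂`; classes and characters read back by `hy`, ★ `localCharOfCenter_theta_eq`.  (At an isotropic `V`, `hsep := ` ★
`rankOne_theta_lines_disjoint_of_isotropic …` gives ★ `…_of_isIsotropic_of_modelTransport`.)
[cite: Liu2021, App. D Lemma D.1 (4) (p. 126, l. 5235), proof l. 5257–5262] [cite: MoeglinVignerasWaldspurger1987, Chap. 3 IV.4]
[cite: HarrisKudlaSweet1996, Cor. 4.4, Thm. 6.1] -/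
theorem sameClass_and_chi_eq_of_areIsomorphicRep_nonsplit_of_separation_of_modelTransport
    (hV : TV.IsSymm) (hVd : IsUnit TV.det) (hJV : JV = TV.map (algebraMap F E))
    (hn : 2 ≤ n) {ι : Type} (aOf : ι → Fˣ) (χOf : ι → Chi F E c)
    (𝓢Of : ∀ i, LocalSplitting.FinLocalSplittings F E c n hcδ hδ hd (gram F e TV (TW F (aOf i))) (isSymm_gram F e hV (isSymm_TW F (aOf i)))
      (reindex_kronecker_eq_gram_map F E e hJV (JW_eq F E (aOf i))))
    (μOf : ι → ∀ v : HeightOneSpectrum (𝓞 F), (LocalRing E v)ˣ →* ℂˣ) (hμn : ∀ i v x, ‖((μOf i v x : ℂˣ) : ℂ)‖ = 1)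
    (hμc : ∀ i v, Continuous fun x => ((μOf i v x : ℂˣ) : ℂ))
    (hμF : ∀ (i : ι) (v : HeightOneSpectrum (𝓞 F)) (t : (v.adicCompletion F)ˣ),
      μOf i v (Units.map (algebraMap (v.adicCompletion F) (LocalRing E v)).toMonoidHom t) = 1 ↔
        ∃ x : (LocalRing E v)ˣ, (x : LocalRing E v) * conjLocal E c v x = algebraMap (v.adicCompletion F) (LocalRing E v) t)
    (v : HeightOneSpectrum (𝓞 F)) (i j : ι)
    (δ' : ι → E) (hδ' : ∀ t, δ' t ≠ 0)
    (hy : ∀ t, ∃ y : (LocalRing E v)ˣ, LemD1OfPlace.eps E v (hδ' t) =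
      y * Units.map (conjLocal E c v : LocalRing E v →* LocalRing E v) y * epsLine E hδ (aOf t) v)
    (s : ι → (localPi E c N JV v →* LocalMp F N TV v))
    (M : ι → (SchwartzBruhat (Fin N → v.adicCompletion F) ≃ₗ[ℂ] SchwartzBruhat (Fin n → v.adicCompletion F)))
    (hM : ∀ (t : ι) (g : localPi E c N JV v) (Φ : SchwartzBruhat (Fin N → v.adicCompletion F)),
      M t (((MpPsi.toRep (localSchrodinger F N TV v)).comp (s t)) g Φ) =
        (show Representation ℂ (localPi E c N JV v) (SchwartzBruhat (Fin n → v.adicCompletion F)) from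
          ((𝓢Of t).omegaLoc v).comp (localLineInl E c N e JV (JW F E (aOf t)) v)) g (M t Φ))
    (hsep : (¬ ∃ x : (LocalRing E v)ˣ, LemD1OfPlace.eps E v (hδ' i) =
        x * Units.map (conjLocal E c v : LocalRing E v →* LocalRing E v) x * LemD1OfPlace.eps E v (hδ' j)) →
      Nontrivial (TwistedCoinv.Coinv
        ((show Representation ℂ (localPi E c 1 (JW F E (aOf j)) v) (SchwartzBruhat (Fin N → v.adicCompletion F)) from
          ((MpPsi.toRep (localSchrodinger F N TV v)).comp (s j)).comp (localCenter E c N JV (JW F E (aOf j)) (JW_apply_ne_zero F E (aOf j)) v)))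
        (localCharOfCenter F E c (JW F E (aOf j)) (JW_apply_ne_zero F E (aOf j)) (χOf j).1 v)) →
      AreIsomorphicRep
        (TwistedCoinv.rep
          (ρW := show Representation ℂ (localPi E c 1 (JW F E (aOf j)) v) (SchwartzBruhat (Fin N → v.adicCompletion F)) from
            ((MpPsi.toRep (localSchrodinger F N TV v)).comp (s j)).comp (localCenter E c N JV (JW F E (aOf j)) (JW_apply_ne_zero F E (aOf j)) v))
          (localCharOfCenter F E c (JW F E (aOf j)) (JW_apply_ne_zero F E (aOf j)) (χOf j).1 v)
          ((MpPsi.toRep (localSchrodinger F N TV v)).comp (s j))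
          (fun g z => (show Commute g (localCenter E c N JV (JW F E (aOf j)) (JW_apply_ne_zero F E (aOf j)) v z) from
            localCenter_comm E c N JV (JW F E (aOf j)) (JW_apply_ne_zero F E (aOf j)) v z g).map ((MpPsi.toRep (localSchrodinger F N TV v)).comp (s j))))
        (TwistedCoinv.rep
          (ρW := show Representation ℂ (localPi E c 1 (JW F E (aOf j)) v) (SchwartzBruhat (Fin N → v.adicCompletion F)) from
            ((MpPsi.toRep (localSchrodinger F N TV v)).comp (s i)).comp (localCenter E c N JV (JW F E (aOf j)) (JW_apply_ne_zero F E (aOf j)) v))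
          (localCharOfCenter F E c (JW F E (aOf j)) (JW_apply_ne_zero F E (aOf j)) (χOf i).1 v)
          ((MpPsi.toRep (localSchrodinger F N TV v)).comp (s i))
          (fun g z => (show Commute g (localCenter E c N JV (JW F E (aOf j)) (JW_apply_ne_zero F E (aOf j)) v z) from
            localCenter_comm E c N JV (JW F E (aOf j)) (JW_apply_ne_zero F E (aOf j)) v z g).map ((MpPsi.toRep (localSchrodinger F N TV v)).comp (s i)))) →
      False)
    (hnt : Nontrivial (TwistedCoinv.Coinv
      (show Representation ℂ (UnitaryGroup.localPi E c 1 (JW F E (aOf j)) v) (SchwartzBruhat (Fin n → v.adicCompletion F)) from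
        ((𝓢Of j).omegaLoc v).comp (localCenter E c n (Matrix.reindex e e (JV ⊗ₖ JW F E (aOf j))) (JW F E (aOf j)) (JW_apply_ne_zero F E (aOf j)) v))
      (localCharOfCenter F E c (JW F E (aOf j)) (JW_apply_ne_zero F E (aOf j)) (χOf j).1 v)))
    (hiso' : AreIsomorphicRep ((localIndexedFamilyAtV₂ F E c N e JV hcδ hδ hd hV hVd hJV hn aOf χOf 𝓢Of μOf hμn hμc hμF v).quot j) ((localIndexedFamilyAtV₂ F E c N e JV hcδ hδ hd hV hVd hJV hn aOf χOf 𝓢Of μOf hμn hμc hμF v).quot i)) :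
    LemD1.SameClass ((localIndexedFamilyAtV₂ F E c N e JV hcδ hδ hd hV hVd hJV hn aOf χOf 𝓢Of μOf hμn hμc hμF v).eps i) ((localIndexedFamilyAtV₂ F E c N e JV hcδ hδ hd hV hVd hJV hn aOf χOf 𝓢Of μOf hμn hμc hμF v).eps j) ∧ (localIndexedFamilyAtV₂ F E c N e JV hcδ hδ hd hV hVd hJV hn aOf χOf 𝓢Of μOf hμn hμc hμF v).chi j = (localIndexedFamilyAtV₂ F E c N e JV hcδ hδ hd hV hVd hJV hn aOf χOf 𝓢Of μOf hμn hμc hμF v).chi i := by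
  have hN : 2 ≤ N := two_le_rank₂'' N e hn
  have hJh : (JV.map c)ᵀ = JV := transpose_map_conj_JV F E c N JV hV hJV
  have hJdet : JV.det ≠ 0 := det_JV_ne_zero F E N JV hVd hJV
  -- (a) both members in the `(U(J_V), ι_{δ′})`-currency (★ §1), at the common line `(a_j)`
  have hj := areIsomorphicRep_theta_comp_uEquiv_quot₂ F E c N e JV hcδ hδ hd hV hVd hJV hn aOf χOf 𝓢Of μOf hμn hμc hμF v j
    (s j) (M j) (hM j) (JW F E (aOf j)) (JW_apply_ne_zero F E (aOf j))
  have hi := areIsomorphicRep_theta_comp_uEquiv_quot₂ F E c N e JV hcδ hδ hd hV hVd hJV hn aOf χOf 𝓢Of μOf hμn hμc hμF v i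
    (s i) (M i) (hM i) (JW F E (aOf j)) (JW_apply_ne_zero F E (aOf j))
  have hisoY := AreIsomorphicRep.of_comp_surjective _
    (LemD1OfPlace.uEquiv E v c N JV hcδ hδ (two_le_rank₂'' N e hn) hJh hJdet).surjective ((hj.trans hiso').trans hi.symm)
  -- (b) `Θ_{s_j}(χ_j) ≠ 0`: the letter's `Θ_v(j) ≠ 0` carried along ★ (r1) and the linear equivalence of §1
  haveI hq := (nontrivial_localType₂_iff_quot F E c N e JV hcδ hδ hd hV hVd hJV hn aOf χOf 𝓢Of μOf hμn hμc hμF v j).2 hnt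
  have hntY : Nontrivial (TwistedCoinv.Coinv
      ((show Representation ℂ (localPi E c 1 (JW F E (aOf j)) v) (SchwartzBruhat (Fin N → v.adicCompletion F)) from
        ((MpPsi.toRep (localSchrodinger F N TV v)).comp (s j)).comp (localCenter E c N JV (JW F E (aOf j)) (JW_apply_ne_zero F E (aOf j)) v)))
      (localCharOfCenter F E c (JW F E (aOf j)) (JW_apply_ne_zero F E (aOf j)) (χOf j).1 v)) := by
    obtain ⟨f, -⟩ := hj
    exact f.toEquiv.nontrivial
  -- (c) the `ε`-clause by contradiction through the separation `hsep`
  have hε : ∃ x : (LocalRing E v)ˣ, LemD1OfPlace.eps E v (hδ' i) =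
      x * Units.map (conjLocal E c v : LocalRing E v →* LocalRing E v) x * LemD1OfPlace.eps E v (hδ' j) := by
    by_contra hcls
    exact hsep hcls hntY hisoY
  -- (d) the `χ`-clause: the centre acts by the character on a non-zero theta lift
  have hχ := rankOne_thetaChar_eq_of_areIsomorphicRep₂ F E c N TV JV v (s j) (s i) (JW F E (aOf j)) (JW_apply_ne_zero F E (aOf j))
    (localCharOfCenter F E c (JW F E (aOf j)) (JW_apply_ne_zero F E (aOf j)) (χOf j).1 v)
    (localCharOfCenter F E c (JW F E (aOf j)) (JW_apply_ne_zero F E (aOf j)) (χOf i).1 v) hntY hisoY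
  refine ⟨?_, ?_⟩
  · obtain ⟨x, hx⟩ := hε
    obtain ⟨yi, hyi⟩ := hy i
    obtain ⟨yj, hyj⟩ := hy j
    exact (sameClass_eps_localIndexedFamilyAtV₂_iff F E c N JV hcδ hδ hd e hV hVd hJV hn aOf χOf 𝓢Of μOf hμn hμc hμF v i j).2
      ⟨(yi⁻¹ * x * yj)⁻¹, sameClass_witness₃ (Units.map (conjLocal E c v : LocalRing E v →* LocalRing E v)) hx hyi hyj⟩
  · refine Subtype.ext (MonoidHom.ext fun z => ?_)
    change localCharOfCenter F E c (JW F E (aOf j)) (JW_apply_ne_zero F E (aOf j)) (χOf j).1 v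
        (LemD1OfPlace.theta E v c N JV hcδ hδ _ _ _ (JW F E (aOf j)) z) =
      localCharOfCenter F E c (JW F E (aOf i)) (JW_apply_ne_zero F E (aOf i)) (χOf i).1 v
        (LemD1OfPlace.theta E v c N JV hcδ hδ _ _ _ (JW F E (aOf i)) z)
    rw [hχ, localCharOfCenter_theta_eq F E c N JV hcδ hδ _ _ _ v (JW F E (aOf j)) (JW F E (aOf i))
      (JW_apply_ne_zero F E (aOf j)) (JW_apply_ne_zero F E (aOf i)) (χOf i).1 z]

/-! ## §3′ The same at the reindexing `Equiv.prodUnique (Fin N) (Fin 1)` with the `e′_a` line-model transport (`M_t = 1`) -/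

/-- **The `(ε, χ)`-clauses at a non-split place FROM THE SEPARATION, at the reindexing `Equiv.prodUnique (Fin N) (Fin 1)`**: §2′ at the `e′_a` transport of ★
`LocalLineModelTransport` (`δ'_t = a_t⁻¹ δ`, `s_t = lineTransportSection …`, `M_t = 1`, ★ `omega_lineTransportSection_finLocalSplittings`, class witness ★
`epsLine_eq_mul_conj_mul_eps_lineDelta`).  The separation `hsep` is now about the two TRANSPORTED sections `lineTransportSection … (a_j) …`, `lineTransportSection … (a_i) …`
on the common model `LocalMp F N T_V v` (lines `a_j⁻¹δ ⊗ 1`, `a_i⁻¹δ ⊗ 1` in different classes → `Θ ≠ 0` → `Θ_j ≅ Θ_i` → `False`) — at an isotropic `V` it is ★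
`rankOne_theta_lines_disjoint_of_isotropic`, at an anisotropic plane it is the matched-splitting organ of the R₂ road.
[cite: Liu2021, App. D Lemma D.1 (4) (p. 126, l. 5235), proof l. 5257–5262] [cite: MoeglinVignerasWaldspurger1987, Chap. 2 II.1, Chap. 3 IV.4]
[cite: HarrisKudlaSweet1996, Cor. 4.4, Thm. 6.1] -/
theorem sameClass_and_chi_eq_of_areIsomorphicRep_nonsplit_of_separation_prodUnique
    (hV : TV.IsSymm) (hVd : IsUnit TV.det) (hJV : JV = TV.map (algebraMap F E)) (hN : 2 ≤ N)
    {ι : Type} (aOf : ι → Fˣ) (χOf : ι → Chi F E c)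
    (𝓢Of : ∀ i, LocalSplitting.FinLocalSplittings F E c N hcδ hδ hd (gram F (Equiv.prodUnique (Fin N) (Fin 1)) TV (TW F (aOf i)))
      (isSymm_gram F (Equiv.prodUnique (Fin N) (Fin 1)) hV (isSymm_TW F (aOf i)))
      (reindex_kronecker_eq_gram_map F E (Equiv.prodUnique (Fin N) (Fin 1)) hJV (JW_eq F E (aOf i))))
    (μOf : ι → ∀ v : HeightOneSpectrum (𝓞 F), (LocalRing E v)ˣ →* ℂˣ) (hμn : ∀ i v x, ‖((μOf i v x : ℂˣ) : ℂ)‖ = 1)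
    (hμc : ∀ i v, Continuous fun x => ((μOf i v x : ℂˣ) : ℂ))
    (hμF : ∀ (i : ι) (v : HeightOneSpectrum (𝓞 F)) (t : (v.adicCompletion F)ˣ),
      μOf i v (Units.map (algebraMap (v.adicCompletion F) (LocalRing E v)).toMonoidHom t) = 1 ↔
        ∃ x : (LocalRing E v)ˣ, (x : LocalRing E v) * conjLocal E c v x = algebraMap (v.adicCompletion F) (LocalRing E v) t)
    (v : HeightOneSpectrum (𝓞 F)) (i j : ι)
    (hsep : (¬ ∃ x : (LocalRing E v)ˣ, LemD1OfPlace.eps E v (lineDelta_ne_zero hδ (aOf i)) =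
        x * Units.map (conjLocal E c v : LocalRing E v →* LocalRing E v) x * LemD1OfPlace.eps E v (lineDelta_ne_zero hδ (aOf j))) →
      Nontrivial (TwistedCoinv.Coinv
        ((show Representation ℂ (localPi E c 1 (JW F E (aOf j)) v) (SchwartzBruhat (Fin N → v.adicCompletion F)) from
          ((MpPsi.toRep (localSchrodinger F N TV v)).comp (lineTransportSection F E c N hcδ hδ hd TV hV JV hJV (aOf j) v ((𝓢Of j).s v) ((𝓢Of j).proj_s v))).comp (localCenter E c N JV (JW F E (aOf j)) (JW_apply_ne_zero F E (aOf j)) v)))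
        (localCharOfCenter F E c (JW F E (aOf j)) (JW_apply_ne_zero F E (aOf j)) (χOf j).1 v)) →
      AreIsomorphicRep
        (TwistedCoinv.rep
          (ρW := show Representation ℂ (localPi E c 1 (JW F E (aOf j)) v) (SchwartzBruhat (Fin N → v.adicCompletion F)) from
            ((MpPsi.toRep (localSchrodinger F N TV v)).comp (lineTransportSection F E c N hcδ hδ hd TV hV JV hJV (aOf j) v ((𝓢Of j).s v) ((𝓢Of j).proj_s v))).comp (localCenter E c N JV (JW F E (aOf j)) (JW_apply_ne_zero F E (aOf j)) v))
          (localCharOfCenter F E c (JW F E (aOf j)) (JW_apply_ne_zero F E (aOf j)) (χOf j).1 v)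
          ((MpPsi.toRep (localSchrodinger F N TV v)).comp (lineTransportSection F E c N hcδ hδ hd TV hV JV hJV (aOf j) v ((𝓢Of j).s v) ((𝓢Of j).proj_s v)))
          (fun g z => (show Commute g (localCenter E c N JV (JW F E (aOf j)) (JW_apply_ne_zero F E (aOf j)) v z) from
            localCenter_comm E c N JV (JW F E (aOf j)) (JW_apply_ne_zero F E (aOf j)) v z g).map ((MpPsi.toRep (localSchrodinger F N TV v)).comp (lineTransportSection F E c N hcδ hδ hd TV hV JV hJV (aOf j) v ((𝓢Of j).s v) ((𝓢Of j).proj_s v)))))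
        (TwistedCoinv.rep
          (ρW := show Representation ℂ (localPi E c 1 (JW F E (aOf j)) v) (SchwartzBruhat (Fin N → v.adicCompletion F)) from
            ((MpPsi.toRep (localSchrodinger F N TV v)).comp (lineTransportSection F E c N hcδ hδ hd TV hV JV hJV (aOf i) v ((𝓢Of i).s v) ((𝓢Of i).proj_s v))).comp (localCenter E c N JV (JW F E (aOf j)) (JW_apply_ne_zero F E (aOf j)) v))
          (localCharOfCenter F E c (JW F E (aOf j)) (JW_apply_ne_zero F E (aOf j)) (χOf i).1 v)
          ((MpPsi.toRep (localSchrodinger F N TV v)).comp (lineTransportSection F E c N hcδ hδ hd TV hV JV hJV (aOf i) v ((𝓢Of i).s v) ((𝓢Of i).proj_s v)))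
          (fun g z => (show Commute g (localCenter E c N JV (JW F E (aOf j)) (JW_apply_ne_zero F E (aOf j)) v z) from
            localCenter_comm E c N JV (JW F E (aOf j)) (JW_apply_ne_zero F E (aOf j)) v z g).map ((MpPsi.toRep (localSchrodinger F N TV v)).comp (lineTransportSection F E c N hcδ hδ hd TV hV JV hJV (aOf i) v ((𝓢Of i).s v) ((𝓢Of i).proj_s v))))) →
      False)
    (hnt : Nontrivial (TwistedCoinv.Coinv
      (show Representation ℂ (UnitaryGroup.localPi E c 1 (JW F E (aOf j)) v) (SchwartzBruhat (Fin N → v.adicCompletion F)) from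
        ((𝓢Of j).omegaLoc v).comp (localCenter E c N (Matrix.reindex (Equiv.prodUnique (Fin N) (Fin 1)) (Equiv.prodUnique (Fin N) (Fin 1)) (JV ⊗ₖ JW F E (aOf j))) (JW F E (aOf j)) (JW_apply_ne_zero F E (aOf j)) v))
      (localCharOfCenter F E c (JW F E (aOf j)) (JW_apply_ne_zero F E (aOf j)) (χOf j).1 v)))
    (hiso' : AreIsomorphicRep ((localIndexedFamilyAtV₂ F E c N (Equiv.prodUnique (Fin N) (Fin 1)) JV hcδ hδ hd hV hVd hJV hN aOf χOf 𝓢Of μOf hμn hμc hμF v).quot j) ((localIndexedFamilyAtV₂ F E c N (Equiv.prodUnique (Fin N) (Fin 1)) JV hcδ hδ hd hV hVd hJV hN aOf χOf 𝓢Of μOf hμn hμc hμF v).quot i)) :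
    LemD1.SameClass ((localIndexedFamilyAtV₂ F E c N (Equiv.prodUnique (Fin N) (Fin 1)) JV hcδ hδ hd hV hVd hJV hN aOf χOf 𝓢Of μOf hμn hμc hμF v).eps i) ((localIndexedFamilyAtV₂ F E c N (Equiv.prodUnique (Fin N) (Fin 1)) JV hcδ hδ hd hV hVd hJV hN aOf χOf 𝓢Of μOf hμn hμc hμF v).eps j) ∧ (localIndexedFamilyAtV₂ F E c N (Equiv.prodUnique (Fin N) (Fin 1)) JV hcδ hδ hd hV hVd hJV hN aOf χOf 𝓢Of μOf hμn hμc hμF v).chi j = (localIndexedFamilyAtV₂ F E c N (Equiv.prodUnique (Fin N) (Fin 1)) JV hcδ hδ hd hV hVd hJV hN aOf χOf 𝓢Of μOf hμn hμc hμF v).chi i :=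
  sameClass_and_chi_eq_of_areIsomorphicRep_nonsplit_of_separation_of_modelTransport F E c N (Equiv.prodUnique (Fin N) (Fin 1)) JV hcδ hδ
    hd hV hVd hJV hN aOf χOf 𝓢Of μOf hμn hμc hμF v i j
    (fun t => algebraMap F E (↑(aOf t)⁻¹ : F) * δ) (fun t => lineDelta_ne_zero hδ (aOf t))
    (fun t => ⟨_, eq_inv_mul_of_eq_mul₃ (Units.map (conjLocal E c v : LocalRing E v →* LocalRing E v))
      (epsLine_eq_mul_conj_mul_eps_lineDelta F E c (aOf t) v (hδ := hδ))⟩)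
    (fun t => lineTransportSection F E c N hcδ hδ hd TV hV JV hJV (aOf t) v ((𝓢Of t).s v) ((𝓢Of t).proj_s v))
    (fun _ => LinearEquiv.refl ℂ _)
    (fun t g Φ => LinearMap.congr_fun
      (DFunLike.congr_fun (omega_lineTransportSection_finLocalSplittings F E c N hcδ hδ hd TV hV JV hJV (aOf t) v (𝓢Of t)) g) Φ)
    hsep hnt hiso'

/-! ## §4′ The same read in the Θ-currency of the θ-package local factors (the tokens of the LD letters R₂ ∕ L4) -/

/-- **THE `(ε, χ)`-CLAUSES IN THE Θ-CURRENCY, FROM THE SEPARATION AT THE PLACE** — the tokens of the letters R₂ ∕ L4 of `LemD1RankTwoCMLetters`: for members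
`i, j` of the rank-`≥ 2` θ-package family at `v` (reindexing `Equiv.prodUnique (Fin N) (Fin 1)`; any lines, any `χ_t`, ANY splitting families, ANY Step-2 characters),
IF the two transported rank-one theta lifts are SEPARATED at `v` (`hsep`, body of ★ `rankOne_theta_lines_disjoint` at the transported sections; ★
`rankOne_theta_lines_disjoint_of_isotropic` at an isotropic `V`, the matched-splitting organ at an anisotropic plane), `Θ_v(j) ≠ 0` (`hnt`) and **`Θ_v(j) ≅ Θ_v(i)`**
as representations of `U(J_V)(F_v)` (`Θ_v(t) = TwistedCoinv.rep (χ_{t,v}) ((𝓢_t).omegaLoc v) _ ∘ (k ↦ k ⊗ 1)`), THEN the lines are in ONE class at `v`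
(`LemD1.SameClass (eps i) (eps j)`: `(a_j δ) ⊗ 1 = x xᶜ ((a_i δ) ⊗ 1)`, = `locF`-equality by ★ `sameClass_epsLine_iff_locF_apply_eq` ∕ ★ `locF_apply_eq_of_sameClass_epsLine`)
and `chi j = chi i` — §3′ through ★ (r1) `areIsomorphicRep_localType₂_iff_quot`.  ORIENTATION for the letter R₂ («`Θ_v(a) ≅ Θ_v(a′)`, `Θ_v(a′) ≠ 0`»): `j := a′`,
`i := a`, isomorphism reversed by ★ `AreIsomorphicRep.symm`.
[cite: Liu2021, App. D Lemma D.1 (4) (p. 126, l. 5235); §D.1 Step 3 (l. 5221)] [cite: MoeglinVignerasWaldspurger1987, Chap. 3 IV.4]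
[cite: HarrisKudlaSweet1996, Cor. 4.4, Thm. 6.1] -/
theorem sameClass_and_chi_eq_of_areIsomorphicRep_localType₂_nonsplit_of_separation
    (hV : TV.IsSymm) (hVd : IsUnit TV.det) (hJV : JV = TV.map (algebraMap F E)) (hN : 2 ≤ N)
    {ι : Type} (aOf : ι → Fˣ) (χOf : ι → Chi F E c)
    (𝓢Of : ∀ i, LocalSplitting.FinLocalSplittings F E c N hcδ hδ hd (gram F (Equiv.prodUnique (Fin N) (Fin 1)) TV (TW F (aOf i)))
      (isSymm_gram F (Equiv.prodUnique (Fin N) (Fin 1)) hV (isSymm_TW F (aOf i)))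
      (reindex_kronecker_eq_gram_map F E (Equiv.prodUnique (Fin N) (Fin 1)) hJV (JW_eq F E (aOf i))))
    (μOf : ι → ∀ v : HeightOneSpectrum (𝓞 F), (LocalRing E v)ˣ →* ℂˣ) (hμn : ∀ i v x, ‖((μOf i v x : ℂˣ) : ℂ)‖ = 1)
    (hμc : ∀ i v, Continuous fun x => ((μOf i v x : ℂˣ) : ℂ))
    (hμF : ∀ (i : ι) (v : HeightOneSpectrum (𝓞 F)) (t : (v.adicCompletion F)ˣ),
      μOf i v (Units.map (algebraMap (v.adicCompletion F) (LocalRing E v)).toMonoidHom t) = 1 ↔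
        ∃ x : (LocalRing E v)ˣ, (x : LocalRing E v) * conjLocal E c v x = algebraMap (v.adicCompletion F) (LocalRing E v) t)
    (v : HeightOneSpectrum (𝓞 F)) (i j : ι)
    (hsep : (¬ ∃ x : (LocalRing E v)ˣ, LemD1OfPlace.eps E v (lineDelta_ne_zero hδ (aOf i)) =
        x * Units.map (conjLocal E c v : LocalRing E v →* LocalRing E v) x * LemD1OfPlace.eps E v (lineDelta_ne_zero hδ (aOf j))) →
      Nontrivial (TwistedCoinv.Coinv
        ((show Representation ℂ (localPi E c 1 (JW F E (aOf j)) v) (SchwartzBruhat (Fin N → v.adicCompletion F)) from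
          ((MpPsi.toRep (localSchrodinger F N TV v)).comp (lineTransportSection F E c N hcδ hδ hd TV hV JV hJV (aOf j) v ((𝓢Of j).s v) ((𝓢Of j).proj_s v))).comp (localCenter E c N JV (JW F E (aOf j)) (JW_apply_ne_zero F E (aOf j)) v)))
        (localCharOfCenter F E c (JW F E (aOf j)) (JW_apply_ne_zero F E (aOf j)) (χOf j).1 v)) →
      AreIsomorphicRep
        (TwistedCoinv.rep
          (ρW := show Representation ℂ (localPi E c 1 (JW F E (aOf j)) v) (SchwartzBruhat (Fin N → v.adicCompletion F)) from
            ((MpPsi.toRep (localSchrodinger F N TV v)).comp (lineTransportSection F E c N hcδ hδ hd TV hV JV hJV (aOf j) v ((𝓢Of j).s v) ((𝓢Of j).proj_s v))).comp (localCenter E c N JV (JW F E (aOf j)) (JW_apply_ne_zero F E (aOf j)) v))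
          (localCharOfCenter F E c (JW F E (aOf j)) (JW_apply_ne_zero F E (aOf j)) (χOf j).1 v)
          ((MpPsi.toRep (localSchrodinger F N TV v)).comp (lineTransportSection F E c N hcδ hδ hd TV hV JV hJV (aOf j) v ((𝓢Of j).s v) ((𝓢Of j).proj_s v)))
          (fun g z => (show Commute g (localCenter E c N JV (JW F E (aOf j)) (JW_apply_ne_zero F E (aOf j)) v z) from
            localCenter_comm E c N JV (JW F E (aOf j)) (JW_apply_ne_zero F E (aOf j)) v z g).map ((MpPsi.toRep (localSchrodinger F N TV v)).comp (lineTransportSection F E c N hcδ hδ hd TV hV JV hJV (aOf j) v ((𝓢Of j).s v) ((𝓢Of j).proj_s v)))))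
        (TwistedCoinv.rep
          (ρW := show Representation ℂ (localPi E c 1 (JW F E (aOf j)) v) (SchwartzBruhat (Fin N → v.adicCompletion F)) from
            ((MpPsi.toRep (localSchrodinger F N TV v)).comp (lineTransportSection F E c N hcδ hδ hd TV hV JV hJV (aOf i) v ((𝓢Of i).s v) ((𝓢Of i).proj_s v))).comp (localCenter E c N JV (JW F E (aOf j)) (JW_apply_ne_zero F E (aOf j)) v))
          (localCharOfCenter F E c (JW F E (aOf j)) (JW_apply_ne_zero F E (aOf j)) (χOf i).1 v)
          ((MpPsi.toRep (localSchrodinger F N TV v)).comp (lineTransportSection F E c N hcδ hδ hd TV hV JV hJV (aOf i) v ((𝓢Of i).s v) ((𝓢Of i).proj_s v)))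
          (fun g z => (show Commute g (localCenter E c N JV (JW F E (aOf j)) (JW_apply_ne_zero F E (aOf j)) v z) from
            localCenter_comm E c N JV (JW F E (aOf j)) (JW_apply_ne_zero F E (aOf j)) v z g).map ((MpPsi.toRep (localSchrodinger F N TV v)).comp (lineTransportSection F E c N hcδ hδ hd TV hV JV hJV (aOf i) v ((𝓢Of i).s v) ((𝓢Of i).proj_s v))))) →
      False)
    (hnt : Nontrivial (TwistedCoinv.Coinv
      (show Representation ℂ (UnitaryGroup.localPi E c 1 (JW F E (aOf j)) v) (SchwartzBruhat (Fin N → v.adicCompletion F)) from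
        ((𝓢Of j).omegaLoc v).comp (localCenter E c N (Matrix.reindex (Equiv.prodUnique (Fin N) (Fin 1)) (Equiv.prodUnique (Fin N) (Fin 1)) (JV ⊗ₖ JW F E (aOf j))) (JW F E (aOf j)) (JW_apply_ne_zero F E (aOf j)) v))
      (localCharOfCenter F E c (JW F E (aOf j)) (JW_apply_ne_zero F E (aOf j)) (χOf j).1 v)))
    (hiso' : AreIsomorphicRep
      (show Representation ℂ (UnitaryGroup.localPi E c N JV v) _ from
        (TwistedCoinv.rep (localCharOfCenter F E c (JW F E (aOf j)) (JW_apply_ne_zero F E (aOf j)) (χOf j).1 v) ((𝓢Of j).omegaLoc v)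
          (commute_omegaLoc_localCenter F E c N (Equiv.prodUnique (Fin N) (Fin 1)) JV (JW F E (aOf j)) hcδ hδ hd hV (isSymm_TW F (aOf j)) hJV
            (JW_eq F E (aOf j)) (JW_apply_ne_zero F E (aOf j)) (𝓢Of j) v)).comp
          (UnitaryGroup.localLineInl E c N (Equiv.prodUnique (Fin N) (Fin 1)) JV (JW F E (aOf j)) v))
      (show Representation ℂ (UnitaryGroup.localPi E c N JV v) _ from
        (TwistedCoinv.rep (localCharOfCenter F E c (JW F E (aOf i)) (JW_apply_ne_zero F E (aOf i)) (χOf i).1 v) ((𝓢Of i).omegaLoc v)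
          (commute_omegaLoc_localCenter F E c N (Equiv.prodUnique (Fin N) (Fin 1)) JV (JW F E (aOf i)) hcδ hδ hd hV (isSymm_TW F (aOf i)) hJV
            (JW_eq F E (aOf i)) (JW_apply_ne_zero F E (aOf i)) (𝓢Of i) v)).comp
          (UnitaryGroup.localLineInl E c N (Equiv.prodUnique (Fin N) (Fin 1)) JV (JW F E (aOf i)) v))) :
    LemD1.SameClass ((localIndexedFamilyAtV₂ F E c N (Equiv.prodUnique (Fin N) (Fin 1)) JV hcδ hδ hd hV hVd hJV hN aOf χOf 𝓢Of μOf hμn hμc hμF v).eps i) ((localIndexedFamilyAtV₂ F E c N (Equiv.prodUnique (Fin N) (Fin 1)) JV hcδ hδ hd hV hVd hJV hN aOf χOf 𝓢Of μOf hμn hμc hμF v).eps j) ∧ (localIndexedFamilyAtV₂ F E c N (Equiv.prodUnique (Fin N) (Fin 1)) JV hcδ hδ hd hV hVd hJV hN aOf χOf 𝓢Of μOf hμn hμc hμF v).chi j = (localIndexedFamilyAtV₂ F E c N (Equiv.prodUnique (Fin N) (Fin 1)) JV hcδ hδ hd hV hVd hJV hN aOf χOf 𝓢Of μOf hμn hμc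 hμF v).chi i :=
  sameClass_and_chi_eq_of_areIsomorphicRep_nonsplit_of_separation_prodUnique F E c N JV hcδ hδ hd hV hVd hJV hN aOf χOf 𝓢Of μOf hμn hμc
    hμF v i j hsep hnt
    ((areIsomorphicRep_localType₂_iff_quot F E c N (Equiv.prodUnique (Fin N) (Fin 1)) JV hcδ hδ hd hV hVd hJV hN aOf χOf 𝓢Of μOf hμn hμc hμF
      v i j).2 hiso')

end Literature.NumberTheory.Automorphic.Liu2021.Def411WeilCarriers

end
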